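import Mathlib
import HarnessLib
import Summits.CriticalPhenomena.CardyFormulaZ2.Statement
import Summits.CriticalPhenomena.CardyFormulaZ2.Theses.CardyAnchoredRigidity

/-!
# Route CardyAnchoredRigidity — the `Assembly` item (stmt-CriticalPhenomena-5771)

The assembly of route `route-CriticalPhenomena-CardyAnchoredRigidity` (sub-problem `CardyFormulaZ2`):

  `SubseqCardy → ClusterSetConnected → CardyShadowIsolated → CardyFormulaZ2`.

Pure point-set topology over the listed items (no named Literature fact, no mathematical content
beyond Tychonoff and the cluster-set lever; sources Hale2010, SchrammSmirnov2011 for the idea):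

* every crossing function `R ↦ bondDomainCrossingProb R δ` lies in the compact box
  `[0,1]^ConformalRectangle` (`bondDomainCrossingProb_mem_Icc` + `isCompact_univ_pi`);
* `SubseqCardy` gives meshes `u n → 0⁺` along which Cardy's formula holds for every uniformizing
  datum; by compactness the sequence of crossing functions has a cluster point `g`, which is then a
  cluster point of the path `δ ↦ (R ↦ bondDomainCrossingProb R δ)` at `0⁺` and a Cardy shadow
  (`g R = F(crossRatio x)` for every uniformizing datum, by uniqueness of limits in each coordinate);
* `CardyShadowIsolated` makes `g` an isolated point of the cluster set and `ClusterSetConnected`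
  makes the cluster set preconnected, so the cluster set is `{g}`;
* a path with values in a compact set and a unique cluster point converges
  (`IsCompact.tendsto_nhds_of_unique_mapClusterPt`); projecting on the coordinate `R` and using the
  shadow identity gives `R.HasCrossingLimit (bondDomainCrossingProb R) φ x`, i.e. `CardyFormulaZ2`.

The proof is the body of the route's deciding theorem `closes`, reproduced here self-contained.
-/

namespace Summit.CriticalPhenomena.CardyFormulaZ2.Theorems

open Summit.CriticalPhenomena.CardyFormulaZ2.Theses.CardyAnchoredRigidity

/-- **Assembly of route CardyAnchoredRigidity** (item stmt-CriticalPhenomena-5771):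
`SubseqCardy → ClusterSetConnected → CardyShadowIsolated → CardyFormulaZ2`.
Compactness of `[0,1]^ConformalRectangle` gives a cluster point of the crossing functions along
`SubseqCardy`'s sequence of meshes, which is a Cardy shadow and a cluster point of the path at `0⁺`;
isolation (`CardyShadowIsolated`) plus preconnectedness of the cluster set (`ClusterSetConnected`)
force the cluster set to be that single point; a path in a compact set with a unique cluster point
converges, and the coordinate projections of that limit are exactly Cardy's formula on `ℤ²`. -/
theorem cardyAnchoredRigidity_assembly_proof :
    Summit.CriticalPhenomena.CardyFormulaZ2.Theses.CardyAnchoredRigidity.Assembly := by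
  unfold Summit.CriticalPhenomena.CardyFormulaZ2.Theses.CardyAnchoredRigidity.Assembly
  intro hSub hConn hIso
  -- (0) every crossing function lives in the compact box [0,1]^ConformalRectangle (Tychonoff)
  have hK : IsCompact (Set.pi Set.univ
      (fun _ : Literature.Probability.RandomPlanarGeometry.ConformalRectangle => Set.Icc (0 : ℝ) 1)) :=
    isCompact_univ_pi fun _ => isCompact_Icc
  have hPK : ∀ δ : ℝ,
      (fun R : Literature.Probability.RandomPlanarGeometry.ConformalRectangle =>
          Literature.Probability.Percolation.bondDomainCrossingProb R δ) ∈
        Set.pi Set.univ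
          (fun _ : Literature.Probability.RandomPlanarGeometry.ConformalRectangle =>
            Set.Icc (0 : ℝ) 1) :=
    fun δ => Set.mem_univ_pi.2 fun R =>
      Literature.Probability.Percolation.bondDomainCrossingProb_mem_Icc R δ
  -- (1) SubseqCardy: a sequence of meshes u n → 0⁺ along which Cardy holds for every datum;
  --     the sequence of crossing functions has a cluster point g in the compact box
  obtain ⟨u, hu, hlim⟩ := hSub
  obtain ⟨g, -, hg⟩ := hK.exists_mapClusterPt_of_frequently (l := Filter.atTop)
    (f := fun (n : ℕ) (R : Literature.Probability.RandomPlanarGeometry.ConformalRectangle) =>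
      Literature.Probability.Percolation.bondDomainCrossingProb R (u n))
    (Filter.Eventually.of_forall fun n => hPK (u n)).frequently
  -- g is a cluster point of the crossing-function path along 𝓝[>] 0 (map u atTop ≤ 𝓝[>] 0)
  have hgL : MapClusterPt g (nhdsWithin (0 : ℝ) (Set.Ioi 0))
      (fun (δ : ℝ) (R : Literature.Probability.RandomPlanarGeometry.ConformalRectangle) =>
        Literature.Probability.Percolation.bondDomainCrossingProb R δ) :=
    MapClusterPt.of_comp hu hg
  -- g is a Cardy shadow
  have hshadow : ∀ (R : Literature.Probability.RandomPlanarGeometry.ConformalRectangle)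
      (φ : Literature.Probability.RandomPlanarGeometry.ConformalEquiv
        UpperHalfPlane.upperHalfPlaneSet R.carrier)
      (x : Fin 4 → ℝ), R.IsUniformizing φ x →
        g R = Literature.Probability.RandomPlanarGeometry.cardyFunction
          (Literature.Probability.RandomPlanarGeometry.crossRatio x) := by
    intro R φ x hux
    have h1 : MapClusterPt (g R) Filter.atTop
        (fun n : ℕ => Literature.Probability.Percolation.bondDomainCrossingProb R (u n)) :=
      hg.continuousAt_comp (continuous_apply R).continuousAt
    have h2 : Filter.map
        (fun n : ℕ => Literature.Probability.Percolation.bondDomainCrossingProb R (u n))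
          Filter.atTop ≤
        nhds (Literature.Probability.RandomPlanarGeometry.cardyFunction
          (Literature.Probability.RandomPlanarGeometry.crossRatio x)) :=
      hlim R φ x hux
    exact eq_of_nhds_neBot (h1.clusterPt.mono h2).neBot
  -- (2) CardyShadowIsolated + ClusterSetConnected force the cluster set into {g}
  obtain ⟨U, hU, hUiso⟩ := hIso g hshadow hgL
  have hΛ : IsPreconnected
      {g' : Literature.Probability.RandomPlanarGeometry.ConformalRectangle → ℝ |
        MapClusterPt g' (nhdsWithin (0 : ℝ) (Set.Ioi 0))
          (fun (δ : ℝ) (R : Literature.Probability.RandomPlanarGeometry.ConformalRectangle) =>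
            Literature.Probability.Percolation.bondDomainCrossingProb R δ)} :=
    hConn
  have hgint : g ∈ interior U := mem_interior_iff_mem_nhds.2 hU
  have hcover : ∀ h : Literature.Probability.RandomPlanarGeometry.ConformalRectangle → ℝ,
      h ∈ interior U ∪
        ({g} : Set (Literature.Probability.RandomPlanarGeometry.ConformalRectangle → ℝ))ᶜ := by
    intro h
    by_cases e : h = g
    · rw [e]
      exact Set.mem_union_left _ hgint
    · exact Set.mem_union_right _ (Set.mem_compl_singleton_iff.2 e)
  have huniq : ∀ g' : Literature.Probability.RandomPlanarGeometry.ConformalRectangle → ℝ,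
      MapClusterPt g' (nhdsWithin (0 : ℝ) (Set.Ioi 0))
        (fun (δ : ℝ) (R : Literature.Probability.RandomPlanarGeometry.ConformalRectangle) =>
          Literature.Probability.Percolation.bondDomainCrossingProb R δ) → g' = g := by
    intro g' hg'
    by_contra hne
    obtain ⟨h, hhΛ, hhU, hhg⟩ := hΛ (interior U)
      ({g} : Set (Literature.Probability.RandomPlanarGeometry.ConformalRectangle → ℝ))ᶜ
      isOpen_interior isOpen_compl_singleton (fun h _ => hcover h)
      ⟨g, hgL, hgint⟩ ⟨g', hg', Set.mem_compl_singleton_iff.2 hne⟩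
    exact (Set.mem_compl_singleton_iff.1 hhg) (hUiso h (interior_subset hhU) hhΛ)
  -- (3) a path with values in a compact set and a unique cluster point there converges
  have htend : Filter.Tendsto
      (fun (δ : ℝ) (R : Literature.Probability.RandomPlanarGeometry.ConformalRectangle) =>
        Literature.Probability.Percolation.bondDomainCrossingProb R δ)
      (nhdsWithin (0 : ℝ) (Set.Ioi 0)) (nhds g) :=
    hK.tendsto_nhds_of_unique_mapClusterPt (Filter.Eventually.of_forall hPK)
      fun g' _ hg' => huniq g' hg'
  -- (4) coordinate projection + the shadow identity = `R.HasCrossingLimit`, i.e. CardyFormulaZ2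
  intro R φ x hux
  have hR := tendsto_pi_nhds.1 htend R
  rw [hshadow R φ x hux] at hR
  exact hR

end Summit.CriticalPhenomena.CardyFormulaZ2.Theorems
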